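import Literature.AnabelianGeometry.AbsoluteAnabelian.AbsTopIThm26vFullCore
import HarnessLib

/-!
# [AbsTopI] Thm 2.6 (v): the general form `Thm26vFull` IS the typed form `Thm26v` when `Θ = {1}`

S. Mochizuki, *Topics in Absolute Anabelian Geometry I* (2012), Thm 2.6 (v) p. 22: "if
`θ²(Π) = Primes`, or there does not exist a unique such maximal subgroup, set `Θ := {1} ⊆ Π`.  Then
`ζ̃(Π) := ζ(Π/Θ) = [k : ℚ_p]` [...] the kernel of `Π ↠ G` may be characterized as the intersection
of the open subgroups `H ⊆ Π` such that `ζ̃(H)/ζ̃(Π) = [Π : H]`."  The tree types (v) twice: the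
special case `FundamentalExtension.Thm26v` (`Θ = {1}`, with `ζ`) and the general form
`FundamentalExtension.Thm26vFull` (with `ζ̃ = zetaTildeInv`, each open `H` carrying its own `Θ_H`);
abc-iut-L4-t4's `thm26vFull_fst_iff_of_thetaSet_two_eq` joins their FIRST clauses.  This PROOF-ONLY
file (abc-iut cell, L-F row «LF-ABSTOP F-0249», seat abc-iut-L4-d1; no definitions, no named facts)
is the full JUNCTION: from `ζ̃ = ζ` whenever `Θ = {1}` (the tree's
`zetaTildeInv_eq_zetaInv_of_thetaSubgroup_eq_bot`, `AbsTopIThm26vFullCore.lean`) one gets `Thm26vFull B ↔ Thm26v B` as soon as `Θ_Π = {1}` and `Θ_H = {1}` for every open `H ≤ Π` — in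
particular whenever `θ²(Π) = θ²(H) = Primes` (the situation `Σ = Primes` of [IUTchI–III]).
HONEST FRAMING: refereed, undisputed material (pure transport along `Π/{1} ≅ Π`); nothing here bears
on [IUTchIII] Cor. 3.12 or asserts anything about abc.
-/

noncomputable section

open Topology

namespace Literature.AnabelianGeometry.AbsoluteAnabelian

universe u

namespace FundamentalExtension

variable (E : FundamentalExtension.{u}) (B : E.MLFBase)

/-- **JUNCTION `Thm26vFull ↔ Thm26v` at `Θ = {1}`**: if `Θ_Π = {1}` and `Θ_H = {1}` for every open
subgroup `H ≤ Π`, the general form of [AbsTopI] Thm 2.6 (v) ("`ζ̃(Π) = [k : ℚ_p]` and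
`Δ = ⋂ {H open | ζ̃(H)/ζ̃(Π) = [Π : H]}`") is literally the typed special case (the same with `ζ`).
[cite: MochizukiAbsTopI2012, Thm 2.6 (v) p.22] -/
theorem thm26vFull_iff_thm26v_of_forall_thetaSubgroup_eq_bot (h : thetaSubgroup E.arith = ⊥)
    (hH : ∀ H : Subgroup E.arith, IsOpen (H : Set E.arith) → thetaSubgroup H = ⊥) :
    E.Thm26vFull B ↔ E.Thm26v B := by
  unfold Thm26vFull Thm26v
  rw [zetaTildeInv_eq_zetaInv_of_thetaSubgroup_eq_bot E.arith h]
  have key : (⨅ (H : Subgroup E.arith) (_ : IsOpen (H : Set E.arith))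
      (_ : zetaTildeInv H = (H.index : ℕ∞) * zetaInv E.arith), H) =
      ⨅ (H : Subgroup E.arith) (_ : IsOpen (H : Set E.arith))
        (_ : zetaInv H = (H.index : ℕ∞) * zetaInv E.arith), H := by
    refine iInf_congr fun H => iInf_congr fun hH' => ?_
    rw [zetaTildeInv_eq_zetaInv_of_thetaSubgroup_eq_bot H (hH H hH')]
  rw [key]

/-- `Thm26vFull → Thm26v` at `Θ = {1}` (the direction consumers of the typed special case need).
[cite: MochizukiAbsTopI2012, Thm 2.6 (v) p.22] -/
theorem thm26v_of_thm26vFull_of_forall_thetaSubgroup_eq_bot (h : thetaSubgroup E.arith = ⊥)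
    (hH : ∀ H : Subgroup E.arith, IsOpen (H : Set E.arith) → thetaSubgroup H = ⊥)
    (hv : E.Thm26vFull B) : E.Thm26v B :=
  (E.thm26vFull_iff_thm26v_of_forall_thetaSubgroup_eq_bot B h hH).1 hv

/-- **JUNCTION in the case `θ² = Primes`** (e.g. `Σ = Primes`, the situation of [IUTchI–III]): if
`θ²(Π) = Primes` and `θ²(H) = Primes` for every open `H ≤ Π`, then `Thm26vFull B ↔ Thm26v B`.
[cite: MochizukiAbsTopI2012, Thm 2.6 (v) p.22] -/
theorem thm26vFull_iff_thm26v_of_forall_thetaSet_two_eq (h : thetaSet E.arith 2 = {l | l.Prime})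
    (hH : ∀ H : Subgroup E.arith, IsOpen (H : Set E.arith) → thetaSet H 2 = {l | l.Prime}) :
    E.Thm26vFull B ↔ E.Thm26v B :=
  E.thm26vFull_iff_thm26v_of_forall_thetaSubgroup_eq_bot B
    (thetaSubgroup_eq_bot_of_thetaSet_two_eq E.arith h)
    fun H hH' => thetaSubgroup_eq_bot_of_thetaSet_two_eq H (hH H hH')

end FundamentalExtension

end Literature.AnabelianGeometry.AbsoluteAnabelian

end
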